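import Summits.AtomisticToContinuum.FouriersLaw.Theorems.BondHeatUncertaintyExtensiveSnapshotIrreversibilityEnergyWindowSkeletonVariation
import Summits.AtomisticToContinuum.FouriersLaw.Theorems.BondHeatUncertaintyExtensiveSnapshotIrreversibilityEnergyWindowForcedSecondVariation
import Summits.AtomisticToContinuum.FouriersLaw.Theorems.BondHeatUncertaintyExtensiveSnapshotIrreversibilityEnergyWindowDriftSecondDerivative

/-!
# Energy window, part V-b2 — pathwise Grönwall bound for the SECOND skeleton variation of the flow

Lineage `stmt-AtomisticToContinuum-9121` (`ExtensiveSnapshotIrreversibility`), K_fix half, leaf S3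
`KernelTemperatureLipschitz`; (G1*ᶜᶜ) ⟸ (SWM)ₐ ∧ (JMˣ)₁ ∧ (JMˣ)₂, (G1ℓ) ⟸ (SWM)_d ∧ (JM) ∧ (JMˣ)₁ ∧
(JMˣ)₂ (critic row 1107).  Cell decomp-a2c, lens «grading / quantitative ladder», generation 80,
part V «SkeletonSecondVariation» ((JMˣ)₂): V-a `…ForcedSecondVariation` · V-b1
`…DriftSecondDerivative` · V-b2 (this file) · V-c `…SkeletonSecondVariationMoments`.

THIS FILE (imports T-a1 `…SkeletonVariation`, V-a, V-b1): for EVERY remainder `r`, skeleton `x`,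
directions `δ, δ'`, level `m` and `s ∈ [0, 1]`,
`‖D²_x X_s^{m}(z, r, x)[δ, δ']‖ ≤ Amp² · skelAbsSum δ · skelAbsSum δ' ·
exp(∫₀ˢ (3A₀ + (3A₁ + B₁) √H(X_u^{m}(z, r, x))) du)`, `Amp = max(|c_L|, |c_R|)`
(`norm_fderiv_fderiv_skelFlowMapAt_le`).  Proof = the plan of memo NODE-g79 §3 (i)–(iii):
the skeleton flow map is the evaluation at `s` of the solution-curve family of
`LangevinChainVariational` (`skelFlowMapAt_eq_solCurve`), so by V-a's jet trick
(`fderiv_fderiv_forcedSolution_family_apply`, `fderiv_fderiv_eval_apply`) its second derivative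
`W = D²X[δ', δ]` solves the SECOND-VARIATION EQUATION
`W(τ) = ∫₀^τ (D²Y(X_u)[w_{δ'}(u)][w_δ(u)] + DY(X_u) W(u)) du` (the forcing family is affine:
`D²g = 0`, `fderiv_forcingCurve`); T-a1's Grönwall lemma
(`norm_le_mul_exp_integral_of_eq_add_integral_of_norm_le`) with S′a's `‖DY‖ ≤ A₀ + A₁√H`,
V-b1's `‖D²Y‖ ≤ B₁√H` and T-a1's first-variation bound (`norm_fderiv_skelFlowMapAt_le`, used
for both directions, exponent monotone in time) give
`‖W(s)‖ ≤ Amp²|δ||δ'| e^{2I_s} J_s e^{I_s} ≤ Amp²|δ||δ'| e^{3I_s + J_s}`,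
`I_s = ∫₀ˢ(A₀ + A₁√H)`, `J_s = ∫₀ˢ B₁√H ≤ e^{J_s}`.  Level- and `κ`-free; no measurability needed.
No typeclass declarations, no new syntax, no options; no proof holes.
[cite: CuneoEckmannHairerReyBellet2018, §3 eq. (3.4)] [folklore]
-/

noncomputable section

namespace Summit.AtomisticToContinuum.FouriersLaw.Theorems.ExtensiveSnapshotIrreversibility.EnergyWindow

open MeasureTheory Filter Topology unitInterval Set
open scoped ENNReal NNReal ContDiff Real
open Literature.MathematicalPhysics.KineticTheory.HeatConduction
open Literature.Probability.Process Literature.Analysis.ODE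

/-! ## 1. Two elementary real-analysis facts -/

/-- `x ≤ exp x`. [folklore] (dedup gate: public twin Literature.NumberTheory.Transcendental.DiazThm1.le_exp_self lives in an unrelated module; kept PRIVATE here) -/
private theorem le_exp_self_real (x : ℝ) : x ≤ Real.exp x := by
  have h := Real.add_one_le_exp x
  linarith

/-- `e^{I}² · J · e^{I} ≤ e^{3I + J}` for every real `I` and `J` (uses `J ≤ e^J`). [folklore] -/
theorem exp_sq_mul_mul_exp_le (x y : ℝ) :
    Real.exp x ^ 2 * y * Real.exp x ≤ Real.exp (3 * x + y) := by
  have h1 : Real.exp x ^ 2 * y * Real.exp x ≤ Real.exp x ^ 2 * Real.exp y * Real.exp x :=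
    mul_le_mul_of_nonneg_right
      (mul_le_mul_of_nonneg_left (le_exp_self_real y) (pow_nonneg (Real.exp_pos x).le 2))
      (Real.exp_pos x).le
  have h2 : Real.exp x ^ 2 * Real.exp y * Real.exp x = Real.exp (3 * x + y) := by
    rw [show 3 * x + y = x + x + (y + x) by ring, Real.exp_add, Real.exp_add, Real.exp_add]
    ring
  exact h1.trans h2.le

/-! ## 2. The pathwise bound -/

section Pathwise

variable {ω₂ lam β γ : ℝ} (hω : 0 < ω₂) (hl : 0 ≤ lam) (hβ : 0 ≤ β) (hγ : 0 ≤ γ) (N : ℕ)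
  (T_L T_R : ℝ)

include hω hl hβ hγ in
/-- **Pathwise Grönwall bound for the second skeleton variation of the flow**, for EVERY
remainder `r`, skeleton `x`, directions `δ, δ'` and `s ∈ [0, 1]`:
`‖D_x(D_x X_s^{m}(z, r, ·)[δ])(x)[δ']‖ ≤ max(|c_L|,|c_R|)² · skelAbsSum δ · skelAbsSum δ' ·
exp(∫₀ˢ (3A₀ + (3A₁ + B₁) √H(X_u^{m}(z, r, x))) du)` — second-variation equation (V-a) +
Grönwall (T-a1) + the drift bounds of S′a / V-b1. [folklore]
[cite: CuneoEckmannHairerReyBellet2018, §3 eq. (3.4)] -/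
theorem norm_fderiv_fderiv_skelFlowMapAt_le {s : ℝ} (hs : s ∈ Icc (0 : ℝ) 1) (m : ℕ)
    (z : PhaseSpace N) (r : WienerPair) (x δ δ' : PairSkeleton m) :
    ‖fderiv ℝ (fun y => fderiv ℝ (skelFlowMapAt ω₂ lam β γ N T_L T_R s m z r) y δ) x δ'‖ ≤
      max |ampL ω₂ lam β γ T_L| |ampR ω₂ lam β γ T_R| ^ 2 * skelAbsSum δ * skelAbsSum δ' *
        Real.exp (∫ u in (0 : ℝ)..s, (3 * driftA₀ ω₂ γ N +
          (3 * driftA₁ lam β N + driftB₁ ω₂ lam β N) *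
            √((pinnedChain ω₂ lam β γ).hamiltonian N
              (skelFlowMapAt ω₂ lam β γ N T_L T_R u m z r x)))) := by
  have hη₀ : Continuous (chainNoise N (ampL ω₂ lam β γ T_L) (ampR ω₂ lam β γ T_R) r) :=
    continuous_chainNoise_rem ω₂ lam β γ N T_L T_R r
  set Hf := skelForcing N m (ampL ω₂ lam β γ T_L) (ampR ω₂ lam β γ T_R) with hHf
  set S := pinnedChainSolCurve hω hl hβ hγ N z hη₀ Hf with hSdef
  have hSd : ContDiff ℝ ∞ S := contDiff_pinnedChainSolCurve hω hl hβ hγ N z hη₀ Hf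
  have hSd2 : ContDiff ℝ ((1 : ℕ∞) + 1 : ℕ∞) S := hSd.of_le (by exact_mod_cast le_top)
  -- Step 1: the target is the second derivative of the solution-curve family, evaluated at `s`
  have hfun : skelFlowMapAt ω₂ lam β γ N T_L T_R s m z r = fun y => S y ⟨s, hs⟩ :=
    funext fun y => skelFlowMapAt_eq_solCurve hω hl hβ hγ N T_L T_R hs m z r y
  rw [hfun, fderiv_fderiv_eval_apply hSd2 le_rfl x δ δ' ⟨s, hs⟩]
  -- Step 2: the second-variation equation (V-a), with `D²g = 0` for the affine forcing family
  have hY2 : ContDiff ℝ ((1 : ℕ∞) + 1 : ℕ∞) ((pinnedChain ω₂ lam β γ).drift N) :=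
    pinnedChain_contDiff_drift ω₂ lam β γ N
  have hg2 : ContDiff ℝ ((1 : ℕ∞) + 1 : ℕ∞) (forcingCurve z hη₀ Hf) :=
    contDiff_forcingCurve z hη₀ Hf
  have hode := fderiv_fderiv_forcedSolution_family_apply (n := 1) (S := S) hY2 hg2 le_rfl
    (forcedRobbinMap_pinnedChainSolCurve hω hl hβ hγ N z hη₀ Hf)
    (eq_pinnedChainSolCurve_of_forcedRobbinMap_eq_zero hω hl hβ hγ N z hη₀ Hf) x δ δ'
  have hDg : fderiv ℝ (fderiv ℝ (forcingCurve z hη₀ Hf)) x δ' δ = 0 := by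
    have h1 : fderiv ℝ (forcingCurve z hη₀ Hf) = fun _ => (momentumLift N).comp Hf := by
      funext y
      refine ContinuousLinearMap.ext fun v => ?_
      rw [fderiv_forcingCurve]
      rfl
    rw [h1, fderiv_const_apply]
    rfl
  -- the clamped curves (they fold into `hode`)
  set W : ℝ → PhaseSpace N := IccExtend zero_le_one (fderiv ℝ (fderiv ℝ S) x δ' δ) with hW
  set Xc : ℝ → PhaseSpace N := IccExtend zero_le_one (S x) with hXc
  set V : ℝ → PhaseSpace N := IccExtend zero_le_one (fderiv ℝ S x δ) with hV
  set V' : ℝ → PhaseSpace N := IccExtend zero_le_one (fderiv ℝ S x δ') with hV'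
  -- the unclamped flow, drift derivative and its `√H` majorant (as in T-a1)
  have hXu : ∀ u ∈ Icc (0 : ℝ) 1, Xc u = skelFlowMapAt ω₂ lam β γ N T_L T_R u m z r x := by
    intro u hu
    rw [hXc, IccExtend_of_mem zero_le_one _ hu]
    rfl
  have hXcont : Continuous fun u => skelFlowMapAt ω₂ lam β γ N T_L T_R u m z r x :=
    continuous_skelFlowMapAt_time hω hl hβ hγ N T_L T_R m z r x
  have hYtop := pinnedChain_contDiff_drift ω₂ lam β γ N (n := ⊤)
  have hAc : Continuous fun u => fderiv ℝ ((pinnedChain ω₂ lam β γ).drift N)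
      (skelFlowMapAt ω₂ lam β γ N T_L T_R u m z r x) :=
    (hYtop.continuous_fderiv (by simp)).comp hXcont
  have hHc := pinnedChain_continuous_hamiltonian ω₂ lam β γ N
  have hac : Continuous fun u => driftA₀ ω₂ γ N + driftA₁ lam β N *
      √((pinnedChain ω₂ lam β γ).hamiltonian N
        (skelFlowMapAt ω₂ lam β γ N T_L T_R u m z r x)) :=
    continuous_const.add (continuous_const.mul ((hHc.comp hXcont).sqrt))
  have hAa : ∀ t v, ‖(fderiv ℝ ((pinnedChain ω₂ lam β γ).drift N)
      (skelFlowMapAt ω₂ lam β γ N T_L T_R t m z r x)) v‖ ≤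
      (driftA₀ ω₂ γ N + driftA₁ lam β N * √((pinnedChain ω₂ lam β γ).hamiltonian N
        (skelFlowMapAt ω₂ lam β γ N T_L T_R t m z r x))) * ‖v‖ :=
    fun t v => norm_fderiv_drift_apply_le hω hl hβ hγ N _ v
  have ha0 : ∀ t, 0 ≤ driftA₀ ω₂ γ N + driftA₁ lam β N *
      √((pinnedChain ω₂ lam β γ).hamiltonian N
        (skelFlowMapAt ω₂ lam β γ N T_L T_R t m z r x)) :=
    fun t => add_nonneg (driftA₀_nonneg hω.le hγ N)
      (mul_nonneg (driftA₁_nonneg lam β N) (Real.sqrt_nonneg _))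
  -- continuity of the clamped curves and of the forcing integrand
  have hW_c : Continuous W := continuous_IccExtend_coe _
  have hXc_c : Continuous Xc := continuous_IccExtend_coe _
  have hV_c : Continuous V := continuous_IccExtend_coe _
  have hV'_c : Continuous V' := continuous_IccExtend_coe _
  have hY3 := pinnedChain_contDiff_drift ω₂ lam β γ N (n := 3)
  have hD2c : Continuous fun y => fderiv ℝ (fderiv ℝ ((pinnedChain ω₂ lam β γ).drift N)) y :=
    (hY3.fderiv_right (m := 2) (by norm_num)).continuous_fderiv (by norm_num)
  have hPc : Continuous fun u => fderiv ℝ (fderiv ℝ ((pinnedChain ω₂ lam β γ).drift N))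
      (Xc u) (V' u) (V u) :=
    ((hD2c.comp hXc_c).clm_apply hV'_c).clm_apply hV_c
  have hAclc : Continuous fun u => fderiv ℝ ((pinnedChain ω₂ lam β γ).drift N) (Xc u) (W u) :=
    ((hYtop.continuous_fderiv (by simp)).comp hXc_c).clm_apply hW_c
  -- Step 3: the integral equation of `W` on `[0, s]`, forcing `∫ D²Y[V'][V]`, linear part unclamped
  have heq : ∀ t ∈ Icc (0 : ℝ) s, W t =
      (∫ u in (0 : ℝ)..t, fderiv ℝ (fderiv ℝ ((pinnedChain ω₂ lam β γ).drift N))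
        (Xc u) (V' u) (V u)) +
      ∫ u in (0 : ℝ)..t, (fderiv ℝ ((pinnedChain ω₂ lam β γ).drift N)
        (skelFlowMapAt ω₂ lam β γ N T_L T_R u m z r x)) (W u) := by
    intro t ht
    have ht1 : t ∈ Icc (0 : ℝ) 1 := ⟨ht.1, ht.2.trans hs.2⟩
    have h1 : W t = fderiv ℝ (fderiv ℝ S) x δ' δ ⟨t, ht1⟩ := IccExtend_of_mem zero_le_one _ ht1
    rw [h1, hode ⟨t, ht1⟩, hDg, ContinuousMap.zero_apply, zero_add]
    have hcoe : ((⟨t, ht1⟩ : I) : ℝ) = t := rfl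
    rw [hcoe, intervalIntegral.integral_add (hPc.intervalIntegrable _ _)
      (hAclc.intervalIntegrable _ _)]
    congr 1
    refine intervalIntegral.integral_congr fun u hu => ?_
    have hu' : u ∈ Icc (0 : ℝ) 1 := by
      rw [uIcc_of_le ht.1] at hu
      exact ⟨hu.1, hu.2.trans ht1.2⟩
    simp only [hXu u hu']
  -- Step 4: the forcing bound `‖∫₀ᵗ D²Y[V'][V]‖ ≤ Amp²|δ||δ'| e^{2 I_s} J_s` on `[0, s]`
  set Amp := max |ampL ω₂ lam β γ T_L| |ampR ω₂ lam β γ T_R| with hAmp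
  have hAmp0 : 0 ≤ Amp := le_max_of_le_left (abs_nonneg _)
  set Is := ∫ u in (0 : ℝ)..s, (driftA₀ ω₂ γ N + driftA₁ lam β N *
      √((pinnedChain ω₂ lam β γ).hamiltonian N
        (skelFlowMapAt ω₂ lam β γ N T_L T_R u m z r x))) with hIs
  set Js := ∫ u in (0 : ℝ)..s, driftB₁ ω₂ lam β N *
      √((pinnedChain ω₂ lam β γ).hamiltonian N
        (skelFlowMapAt ω₂ lam β γ N T_L T_R u m z r x)) with hJs
  have hbc : Continuous fun u => driftB₁ ω₂ lam β N *
      √((pinnedChain ω₂ lam β γ).hamiltonian N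
        (skelFlowMapAt ω₂ lam β γ N T_L T_R u m z r x)) :=
    continuous_const.mul ((hHc.comp hXcont).sqrt)
  have hb0 : ∀ u, 0 ≤ driftB₁ ω₂ lam β N *
      √((pinnedChain ω₂ lam β γ).hamiltonian N
        (skelFlowMapAt ω₂ lam β γ N T_L T_R u m z r x)) :=
    fun u => mul_nonneg (driftB₁_nonneg hl hβ N) (Real.sqrt_nonneg _)
  -- monotonicity of the exponent in time
  have hImono : ∀ u ∈ Icc (0 : ℝ) s, (∫ v in (0 : ℝ)..u, (driftA₀ ω₂ γ N + driftA₁ lam β N *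
      √((pinnedChain ω₂ lam β γ).hamiltonian N
        (skelFlowMapAt ω₂ lam β γ N T_L T_R v m z r x)))) ≤ Is :=
    fun u hu => intervalIntegral.integral_mono_interval le_rfl hu.1 hu.2
      (Filter.Eventually.of_forall fun v => ha0 v) (hac.intervalIntegrable _ _)
  -- first variations (T-a1), both directions, for `u ∈ [0, s]`
  have hVb : ∀ u ∈ Icc (0 : ℝ) s, ‖V u‖ ≤ Amp * skelAbsSum δ * Real.exp Is := by
    intro u hu
    have hu1 : u ∈ Icc (0 : ℝ) 1 := ⟨hu.1, hu.2.trans hs.2⟩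
    have h := norm_fderiv_skelFlowMapAt_le hω hl hβ hγ N T_L T_R hu1 m z r x δ
    rw [fderiv_skelFlowMapAt_apply hω hl hβ hγ N T_L T_R hu1 m z r x δ] at h
    refine h.trans (mul_le_mul_of_nonneg_left (Real.exp_le_exp.2 (hImono u hu))
      (mul_nonneg hAmp0 (skelAbsSum_nonneg δ)))
  have hV'b : ∀ u ∈ Icc (0 : ℝ) s, ‖V' u‖ ≤ Amp * skelAbsSum δ' * Real.exp Is := by
    intro u hu
    have hu1 : u ∈ Icc (0 : ℝ) 1 := ⟨hu.1, hu.2.trans hs.2⟩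
    have h := norm_fderiv_skelFlowMapAt_le hω hl hβ hγ N T_L T_R hu1 m z r x δ'
    rw [fderiv_skelFlowMapAt_apply hω hl hβ hγ N T_L T_R hu1 m z r x δ'] at h
    refine h.trans (mul_le_mul_of_nonneg_left (Real.exp_le_exp.2 (hImono u hu))
      (mul_nonneg hAmp0 (skelAbsSum_nonneg δ')))
  set K := Amp ^ 2 * skelAbsSum δ * skelAbsSum δ' * Real.exp Is ^ 2 with hK
  have hK0 : 0 ≤ K := by
    have := skelAbsSum_nonneg δ
    have := skelAbsSum_nonneg δ'
    positivity
  have hPb : ∀ u ∈ Icc (0 : ℝ) s, ‖fderiv ℝ (fderiv ℝ ((pinnedChain ω₂ lam β γ).drift N))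
      (Xc u) (V' u) (V u)‖ ≤ K * (driftB₁ ω₂ lam β N *
        √((pinnedChain ω₂ lam β γ).hamiltonian N
          (skelFlowMapAt ω₂ lam β γ N T_L T_R u m z r x))) := by
    intro u hu
    have hu1 : u ∈ Icc (0 : ℝ) 1 := ⟨hu.1, hu.2.trans hs.2⟩
    have h := norm_fderiv_fderiv_drift_le N hω hl hβ (γ := γ) (Xc u) (V' u) (V u)
    rw [hXu u hu1] at h ⊢
    refine h.trans ?_
    calc driftB₁ ω₂ lam β N * √((pinnedChain ω₂ lam β γ).hamiltonian N
            (skelFlowMapAt ω₂ lam β γ N T_L T_R u m z r x)) * ‖V' u‖ * ‖V u‖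
        ≤ driftB₁ ω₂ lam β N * √((pinnedChain ω₂ lam β γ).hamiltonian N
            (skelFlowMapAt ω₂ lam β γ N T_L T_R u m z r x)) *
            (Amp * skelAbsSum δ' * Real.exp Is) * (Amp * skelAbsSum δ * Real.exp Is) :=
          mul_le_mul (mul_le_mul_of_nonneg_left (hV'b u hu) (hb0 u)) (hVb u hu) (norm_nonneg _)
            (mul_nonneg (hb0 u) (by have := skelAbsSum_nonneg δ'; positivity))
      _ = K * (driftB₁ ω₂ lam β N * √((pinnedChain ω₂ lam β γ).hamiltonian N
            (skelFlowMapAt ω₂ lam β γ N T_L T_R u m z r x))) := by rw [hK]; ring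
  have hfb : ∀ t ∈ Icc (0 : ℝ) s, ‖∫ u in (0 : ℝ)..t, fderiv ℝ (fderiv ℝ
      ((pinnedChain ω₂ lam β γ).drift N)) (Xc u) (V' u) (V u)‖ ≤ K * Js := by
    intro t ht
    have hsub : ∀ u ∈ Icc (0 : ℝ) t, u ∈ Icc (0 : ℝ) s := fun u hu => ⟨hu.1, hu.2.trans ht.2⟩
    calc ‖∫ u in (0 : ℝ)..t, fderiv ℝ (fderiv ℝ ((pinnedChain ω₂ lam β γ).drift N))
          (Xc u) (V' u) (V u)‖
        ≤ ∫ u in (0 : ℝ)..t, ‖fderiv ℝ (fderiv ℝ ((pinnedChain ω₂ lam β γ).drift N))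
            (Xc u) (V' u) (V u)‖ := intervalIntegral.norm_integral_le_integral_norm ht.1
      _ ≤ ∫ u in (0 : ℝ)..t, K * (driftB₁ ω₂ lam β N *
            √((pinnedChain ω₂ lam β γ).hamiltonian N
              (skelFlowMapAt ω₂ lam β γ N T_L T_R u m z r x))) :=
          intervalIntegral.integral_mono_on ht.1 (hPc.norm.intervalIntegrable _ _)
            ((continuous_const.mul hbc).intervalIntegrable _ _) fun u hu => hPb u (hsub u hu)
      _ = K * ∫ u in (0 : ℝ)..t, driftB₁ ω₂ lam β N *
            √((pinnedChain ω₂ lam β γ).hamiltonian N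
              (skelFlowMapAt ω₂ lam β γ N T_L T_R u m z r x)) :=
          intervalIntegral.integral_const_mul _ _
      _ ≤ K * Js :=
          mul_le_mul_of_nonneg_left (intervalIntegral.integral_mono_interval le_rfl ht.1 ht.2
            (Filter.Eventually.of_forall fun v => hb0 v) (hbc.intervalIntegrable _ _)) hK0
  -- Step 5: Grönwall (T-a1 §2) on `[0, s]`
  have hmain := norm_le_mul_exp_integral_of_eq_add_integral_of_norm_le (T := s) hW_c hAc hac
    hAa ha0 hfb heq ⟨hs.1, le_rfl⟩
  -- Step 6: `W s` is the target, and `K J_s e^{I_s} ≤ Amp² |δ| |δ'| e^{3 I_s + J_s}`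
  have hWs : W s = fderiv ℝ (fderiv ℝ S) x δ' δ ⟨s, hs⟩ := IccExtend_of_mem zero_le_one _ hs
  rw [← hWs]
  refine hmain.trans ?_
  have hlin : 3 * Is + Js = ∫ u in (0 : ℝ)..s, (3 * driftA₀ ω₂ γ N +
      (3 * driftA₁ lam β N + driftB₁ ω₂ lam β N) *
        √((pinnedChain ω₂ lam β γ).hamiltonian N
          (skelFlowMapAt ω₂ lam β γ N T_L T_R u m z r x))) := by
    have hi1 : IntervalIntegrable (fun u => 3 * (driftA₀ ω₂ γ N + driftA₁ lam β N *
        √((pinnedChain ω₂ lam β γ).hamiltonian N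
          (skelFlowMapAt ω₂ lam β γ N T_L T_R u m z r x)))) volume 0 s :=
      (continuous_const.mul hac).intervalIntegrable _ _
    rw [hIs, hJs, ← intervalIntegral.integral_const_mul,
      ← intervalIntegral.integral_add hi1 (hbc.intervalIntegrable _ _)]
    refine intervalIntegral.integral_congr fun u _ => ?_
    ring
  rw [← hlin]
  have hδ := skelAbsSum_nonneg δ
  have hδ' := skelAbsSum_nonneg δ'
  calc K * Js * Real.exp Is
      = Amp ^ 2 * skelAbsSum δ * skelAbsSum δ' * (Real.exp Is ^ 2 * Js * Real.exp Is) := by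
        rw [hK]; ring
    _ ≤ Amp ^ 2 * skelAbsSum δ * skelAbsSum δ' * Real.exp (3 * Is + Js) :=
        mul_le_mul_of_nonneg_left (exp_sq_mul_mul_exp_le Is Js) (by positivity)

end Pathwise

end Summit.AtomisticToContinuum.FouriersLaw.Theorems.ExtensiveSnapshotIrreversibility.EnergyWindow

end
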